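import Summits.QuantumFields.YangMills.Theorems.BalabanLadderUVSeamRecGaussianCalibrationLaw
import Mathlib.Probability.Distributions.Gaussian.IsGaussianProcess.Independence
import Mathlib.Probability.ConditionalExpectation
import Mathlib.MeasureTheory.Function.ConditionalExpectation.PullOut
import Mathlib.Probability.Moments.Covariance
import HarnessLib

/-!
# Crux `UVSeamRec` (stmt-QuantumFields-20043), free-field calibration of (RM), file 4: the free-field KERNEL — the conditional expectation of
# the squared gradient given the exterior field is the squared gradient of the harmonic extension plus a constant

Helper file (`--supports stmt-QuantumFields-20043`) of the seam seat `ym-20043-seam-s2` (gen 3); theorems only, no definitions; general `d ≥ 3`.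

WHY.  The free-field calibration of the registered v5(α) stub `BirthV5A.stub_responseMomentsOdd6 : UV → (RM)` (files `…GaussianCalibration*`,
final law `…GaussianCalibrationLaw.gff_responseMoments`) is stated for `Q = (∇_j(φ − ψ^Λ)(x))²`, the squared centre gradient of the harmonic
extension `φ − ψ^Λ = φ − dirichletField Λ φ` of the exterior field.  This file makes the DICTIONARY with (RM)'s femto kernel `kerE` (a conditional
expectation given the exterior configuration) a theorem: for the lattice GFF `ν` of `ℤ^d` (`IsDiscreteGFF`, canonical space),
`ν[(φ_{x+e_j} − φ_x)² | σ(φ_w : w ∉ Λ)] = Q + ∫(∇_jψ^Λ(x))² dν`  a.e.  (`condExp_gradient_sq_exterior`),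
and, as a corollary (§3, `d = 4`), the (RM) calibration law `gff_responseMoments` restated with the conditional expectations themselves
(`gff_responseMoments_condExp`) — by the domain Markov property in independence form: the finite-volume field `(ψ^Λ_u)_{u∈Λ}` is jointly Gaussian with, uncorrelated with
(`E[ψ^Λ_u φ_w] = G_Λ(u,w) = 0` off `Λ`, tree `integral_dirichletField_mul_coord`), hence INDEPENDENT of the whole exterior field `(φ_w)_{w∉Λ}`
(`indepFun_dirichletField_exterior`; the tree's `indepFun_markovRemainder_boundary` is the boundary case), while `∇_j(φ − ψ^Λ)(x)` is an exterior
(boundary) statistic; then `E[(a+b)²|𝓕] = a² + E b²` for `a` `𝓕`-measurable and `b` independent of `𝓕` with mean `0`.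

No sorry, standard axioms.  HONEST FRAMING: the Markov property of the lattice free field (folklore, Friedli–Velenik Thm. 8.21) in Mathlib's `condExp`
language; a dictionary lemma for a CALIBRATION of one OPEN binder of a CONDITIONAL chain; nothing of E0′, not a gap, not Clay.
References: S. Friedli, Y. Velenik, *Statistical Mechanics of Lattice Systems* (2017), Thm. 8.21 / Prop. 8.7.
-/

set_option autoImplicit false

noncomputable section

open MeasureTheory ProbabilityTheory Finset
open Literature.Probability.LatticeModels

namespace Summit.QuantumFields.YangMills.Cruxes.UVSeamRec.GaussianCalibration

variable {d : ℕ} {ν : Measure (Site d → ℝ)}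

/-! ## §1 Joint Gaussianity and independence of the finite-volume field from the exterior field -/

/-- The finite-volume field on `Λ` together with the exterior field is a Gaussian process under the GFF (both are finite linear combinations of
coordinates). [folklore] -/
theorem isGaussianProcess_dirichletField_sumElim_exterior (hν : IsDiscreteGFF ν (coordProc d)) (Λ : Finset (Site d)) :
    IsGaussianProcess (Sum.elim (fun (u : ↥Λ) (φ : Site d → ℝ) => dirichletField Λ φ u)
      (fun (w : {w : Site d // w ∉ Λ}) (φ : Site d → ℝ) => φ w)) ν := by
  classical
  refine hν.1.of_isGaussianProcess fun s => ?_
  rcases s with u | w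
  · set I : Finset (Site d) := insert (u : Site d) (outerBoundary (zdGraph d) Λ) with hI
    refine ⟨I, ContinuousLinearMap.proj (R := ℝ) (⟨u, Finset.mem_insert_self _ _⟩ : I) -
      ∑ z ∈ (outerBoundary (zdGraph d) Λ).attach, Literature.Probability.LatticeModels.poissonKernel Λ u z •
        ContinuousLinearMap.proj (R := ℝ) (⟨z.1, Finset.mem_insert_of_mem z.2⟩ : I), fun φ => ?_⟩
    simp only [Sum.elim_inl, dirichletField_of_mem φ u.2, coordProc, FunLike.coe_sub, FunLike.coe_sum,
      FunLike.coe_smul, Pi.sub_apply, Finset.sum_apply, Pi.smul_apply,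
      ContinuousLinearMap.proj_apply, Finset.restrict_def, smul_eq_mul]
    congr 1
    exact (Finset.sum_attach (outerBoundary (zdGraph d) Λ)
      fun z => Literature.Probability.LatticeModels.poissonKernel Λ u z * φ z).symm
  · refine ⟨{(w : Site d)}, ContinuousLinearMap.proj (R := ℝ) (⟨w, Finset.mem_singleton_self _⟩ : ({(w : Site d)} : Finset (Site d))),
      fun φ => ?_⟩
    simp [coordProc, Finset.restrict_def]

/-- **Domain Markov property, independence form, full exterior**: the finite-volume field `(ψ^Λ_u)_{u ∈ Λ}` is independent of the exterior
field `(φ_w)_{w ∉ Λ}` (jointly Gaussian and uncorrelated: `E[ψ^Λ_u φ_w] = G_Λ(u,w) = 0` off `Λ`). [cite: FriedliVelenik2017, Ch. 8 Thm. 8.21] -/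
theorem indepFun_dirichletField_exterior (hν : IsDiscreteGFF ν (coordProc d)) (hd : 3 ≤ d) (Λ : Finset (Site d)) :
    IndepFun (fun (φ : Site d → ℝ) (u : ↥Λ) => dirichletField Λ φ u)
      (fun (φ : Site d → ℝ) (w : {w : Site d // w ∉ Λ}) => φ w) ν := by
  have hP := hν.1.isProbabilityMeasure
  have hG := isGaussianProcess_dirichletField_sumElim_exterior hν Λ
  refine hG.indepFun_of_covariance_eq_zero (fun u => (hG.hasGaussianLaw_eval (Sum.inl u)).aemeasurable)
    (fun w => (hG.hasGaussianLaw_eval (Sum.inr w)).aemeasurable) fun u w => ?_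
  rw [covariance_eq_sub (((hν.isGaussianProcess_dirichletField Λ).hasGaussianLaw_eval _).memLp_two) (hν.memLp_coord _)]
  have h1 : ∫ φ, ((fun φ : Site d → ℝ => dirichletField Λ φ u) * fun φ : Site d → ℝ => φ w) φ ∂ν = 0 := by
    simp only [Pi.mul_apply]
    rw [hν.integral_dirichletField_mul_coord hd Λ u w, dirichletGreen_of_not_mem_right Λ _ w.2]
  rw [h1, hν.integral_dirichletField Λ u]
  simp

/-! ## §2 The conditional expectation of the squared gradient given the exterior field -/

/-- **The free-field kernel.**  For the lattice GFF `ν` of `ℤ^d` (`d ≥ 3`), a finite `Λ` and `x, x + e_j ∈ Λ`: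
`ν[(φ_{x+e_j} − φ_x)² | σ(φ_w : w ∉ Λ)] = (∇_j(φ − ψ^Λ)(x))² + ∫ (∇_jψ^Λ(x))² dν`  a.e.,
`ψ^Λ = dirichletField Λ φ` — the conditional expectation of the squared gradient given the exterior field is the squared gradient of the
harmonic extension of the exterior data plus the (deterministic) Dirichlet variance: the free-field analogue of (RM)'s femto plane kernel `kerE`.
[cite: FriedliVelenik2017, Ch. 8 Thm. 8.21] -/
theorem condExp_gradient_sq_exterior (hν : IsDiscreteGFF ν (coordProc d)) (hd : 3 ≤ d) (Λ : Finset (Site d)) {x : Site d}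
    {j : Fin d} (hx : x ∈ Λ) (hxe : x + Pi.single j 1 ∈ Λ) :
    ν[fun φ : Site d → ℝ => (φ (x + Pi.single j 1) - φ x) ^ 2 |
        MeasurableSpace.comap (fun (φ : Site d → ℝ) (w : {w : Site d // w ∉ Λ}) => φ w) inferInstance] =ᵐ[ν]
      fun φ => ((φ (x + Pi.single j 1) - dirichletField Λ φ (x + Pi.single j 1)) - (φ x - dirichletField Λ φ x)) ^ 2 +
        ∫ φ', (dirichletField Λ φ' (x + Pi.single j 1) - dirichletField Λ φ' x) ^ 2 ∂ν := by
  classical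
  have hP := hν.1.isProbabilityMeasure
  -- the two σ-algebras
  set ext : (Site d → ℝ) → ({w : Site d // w ∉ Λ} → ℝ) := fun φ w => φ w with hext
  set ψv : (Site d → ℝ) → (↥Λ → ℝ) := fun φ u => dirichletField Λ φ u with hψv
  have hext_m : Measurable ext := measurable_pi_lambda _ fun w => measurable_pi_apply _
  have hψv_m : Measurable ψv := measurable_pi_lambda _ fun u => measurable_dirichletField Λ _
  set mE : MeasurableSpace (Site d → ℝ) := MeasurableSpace.comap ext inferInstance with hmE
  set mΨ : MeasurableSpace (Site d → ℝ) := MeasurableSpace.comap ψv inferInstance with hmΨ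
  have hmE : mE ≤ MeasurableSpace.pi := hext_m.comap_le
  have hmΨ : mΨ ≤ MeasurableSpace.pi := hψv_m.comap_le
  have hind : Indep mΨ mE ν := by
    have h := indepFun_dirichletField_exterior hν hd Λ
    rw [IndepFun_iff_Indep] at h
    exact h
  -- the exterior part `a` and the Dirichlet part `b` of the gradient
  set a : (Site d → ℝ) → ℝ := fun φ =>
    (φ (x + Pi.single j 1) - dirichletField Λ φ (x + Pi.single j 1)) - (φ x - dirichletField Λ φ x) with ha
  set b : (Site d → ℝ) → ℝ := fun φ => dirichletField Λ φ (x + Pi.single j 1) - dirichletField Λ φ x with hb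
  have hab : ∀ φ : Site d → ℝ, (φ (x + Pi.single j 1) - φ x) ^ 2 = (a φ) ^ 2 + 2 * a φ * b φ + (b φ) ^ 2 := by
    intro φ; simp only [ha, hb]; ring
  -- `a` is a function of the exterior field (boundary statistic), `b` of the Dirichlet field
  set ga : ({w : Site d // w ∉ Λ} → ℝ) → ℝ := fun y =>
    ∑ z ∈ (outerBoundary (zdGraph d) Λ).attach,
      (Literature.Probability.LatticeModels.poissonKernel Λ (x + Pi.single j 1) z -
        Literature.Probability.LatticeModels.poissonKernel Λ x z) * y ⟨z.1, (mem_outerBoundary_iff.1 z.2).1⟩ with hga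
  have hga_m : Measurable ga := Finset.measurable_sum _ fun z _ => measurable_const.mul (measurable_pi_apply _)
  have ha_eq : a = ga ∘ ext := by
    funext φ
    simp only [ha, hga, hext, Function.comp_apply, dirichletField_of_mem φ hx, dirichletField_of_mem φ hxe, sub_sub_cancel]
    rw [← Finset.sum_sub_distrib, ← Finset.sum_attach (outerBoundary (zdGraph d) Λ)]
    exact Finset.sum_congr rfl fun z _ => by ring
  set gb : (↥Λ → ℝ) → ℝ := fun y => y ⟨x + Pi.single j 1, hxe⟩ - y ⟨x, hx⟩ with hgb
  have hgb_m : Measurable gb := (measurable_pi_apply _).sub (measurable_pi_apply _)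
  have hb_eq : b = gb ∘ ψv := by funext φ; simp [hb, hgb, hψv]
  have ha_sm : StronglyMeasurable[mE] a := by
    rw [ha_eq]; exact (hga_m.comp (comap_measurable ext)).stronglyMeasurable
  have hb_sm : StronglyMeasurable[mΨ] b := by
    rw [hb_eq]; exact (hgb_m.comp (comap_measurable ψv)).stronglyMeasurable
  have hb2_sm : StronglyMeasurable[mΨ] (fun φ => (b φ) ^ 2) := hb_sm.pow 2
  -- square integrability
  have hψ2 : ∀ y : Site d, MemLp (fun φ : Site d → ℝ => dirichletField Λ φ y) 2 ν := fun y =>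
    ((hν.isGaussianProcess_dirichletField Λ).hasGaussianLaw_eval y).memLp_two
  have haL2 : MemLp a 2 ν := ((hν.memLp_coord _).sub (hψ2 _)).sub ((hν.memLp_coord _).sub (hψ2 _))
  have hbL2 : MemLp b 2 ν := (hψ2 _).sub (hψ2 _)
  have ha2i : Integrable (fun φ => (a φ) ^ 2) ν := haL2.integrable_sq
  have hb2i : Integrable (fun φ => (b φ) ^ 2) ν := hbL2.integrable_sq
  have hbi : Integrable b ν := hbL2.integrable one_le_two
  have habi : Integrable (fun φ => 2 * a φ * b φ) ν := by
    have h := (haL2.integrable_mul hbL2).const_mul 2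
    refine h.congr (Filter.Eventually.of_forall fun φ => ?_)
    simp only [Pi.mul_apply]; ring
  have hb0 : ∫ φ, b φ ∂ν = 0 := by
    simp only [hb]
    rw [integral_sub ((hψ2 _).integrable one_le_two) ((hψ2 _).integrable one_le_two),
      hν.integral_dirichletField, hν.integral_dirichletField, sub_zero]
  -- the three conditional expectations
  have h1 : ν[fun φ => (a φ) ^ 2 | mE] = fun φ => (a φ) ^ 2 :=
    condExp_of_stronglyMeasurable hmE (ha_sm.pow 2) ha2i
  have h2 : ν[fun φ => 2 * a φ * b φ | mE] =ᵐ[ν] fun _ => (0 : ℝ) := by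
    have e1 : (fun φ => 2 * a φ * b φ) = (fun φ => 2 * a φ) * b := by funext φ; simp [Pi.mul_apply]
    have h2a : StronglyMeasurable[mE] (fun φ => 2 * a φ) := ha_sm.const_mul 2
    have hprod : Integrable ((fun φ => 2 * a φ) * b) ν := by rw [← e1]; exact habi
    have h := condExp_mul_of_stronglyMeasurable_left (μ := ν) h2a hprod hbi
    have hb' : ν[b | mE] =ᵐ[ν] fun _ => ∫ φ, b φ ∂ν :=
      condExp_indep_eq (m₁ := mΨ) (m₂ := mE) hmΨ hmE hb_sm hind
    rw [e1]
    filter_upwards [h, hb'] with φ hφ hφ'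
    rw [hφ, Pi.mul_apply, hφ', hb0, mul_zero]
  have h3 : ν[fun φ => (b φ) ^ 2 | mE] =ᵐ[ν] fun _ => ∫ φ, (b φ) ^ 2 ∂ν :=
    condExp_indep_eq (m₁ := mΨ) (m₂ := mE) hmΨ hmE hb2_sm hind
  -- assemble
  have hsum : (fun φ : Site d → ℝ => (φ (x + Pi.single j 1) - φ x) ^ 2) =
      (fun φ => (a φ) ^ 2) + (fun φ => 2 * a φ * b φ) + fun φ => (b φ) ^ 2 := by
    funext φ; simp only [Pi.add_apply, hab]
  rw [hsum]
  have hadd1 := condExp_add (ha2i.add habi) hb2i mE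
  have hadd2 := condExp_add ha2i habi mE
  filter_upwards [hadd1, hadd2, h2, h3] with φ e1 e2 e3 e4
  have e1' : (ν[(fun φ => (a φ) ^ 2) + (fun φ => 2 * a φ * b φ) + fun φ => (b φ) ^ 2 | mE]) φ =
      (ν[(fun φ => (a φ) ^ 2) + (fun φ => 2 * a φ * b φ) | mE]) φ + (ν[fun φ => (b φ) ^ 2 | mE]) φ := by
    rw [show ((fun φ => (a φ) ^ 2) + (fun φ => 2 * a φ * b φ) + fun φ => (b φ) ^ 2) =
      ((fun φ => (a φ) ^ 2) + (fun φ => 2 * a φ * b φ)) + (fun φ => (b φ) ^ 2) from rfl, ]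
    exact e1
  rw [e1', e2, Pi.add_apply, h1, e3, e4, add_zero]

/-! ## §3 The (RM) calibration law stated with the conditional expectations themselves (`d = 4`) -/

section CondExpLaw

open Literature.MathematicalPhysics.QuantumFieldTheory.LatticeForm (e)
open Summit.QuantumFields.YangMills.Theorems.WeakCouplingRates.HarmonicInterior

variable {ν4 : Measure (Site 4 → ℝ)}

/-- **(RM) in the free field, conditional-expectation form.**  There are ABSOLUTE `C₁ > 0`, `B` such that for the lattice GFF `ν` of `ℤ⁴`, every
`R ≥ 1`, all directions `j_i` and centres `x_i` pairwise `2R+4`-separated in some coordinate, and every sub-family `T`: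
`∫ exp( Σ_{i∈T} (R⁴/C₁)·|ν[(φ_{x_i+e_{j_i}} − φ_{x_i})² | σ(φ_w : w ∉ Λ_i)] − ∫(φ_{x_i+e_{j_i}} − φ_{x_i})² dν| ) dν ≤ exp(B·#T)`,
`Λ_i = x_i + sbox(R+1)`: joint exponential RESPONSE MOMENTS, at weight `R⁴/C₁`, of the CONDITIONAL EXPECTATIONS of the squared gradients at the
cube centres given the exterior fields, centred at the unconditional means — word for word the registered stub body `ResponseMomentsDefs.ResponseMomentsOdd6SU2`
(kernel `kerE` = conditional expectation given the exterior, reference values `p` = the means) with the Wilson state on the torus replaced by the massless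
lattice free field on `ℤ⁴`.  Proof: `…Law.gff_responseMoments` and the free-field kernel identity `condExp_gradient_sq_exterior`
(the Dirichlet variances cancel against the means). [cite: FriedliVelenik2017, Ch. 8 Thm. 8.21] -/
theorem gff_responseMoments_condExp (hν : IsDiscreteGFF ν4 (coordProc 4)) :
    ∃ C₁ B : ℝ, 0 < C₁ ∧ ∀ (R : ℕ), 1 ≤ R → ∀ (n : ℕ) (j : Fin n → Fin 4) (x : Fin n → Site 4),
      (∀ i i' : Fin n, i ≠ i' → ∃ k : Fin 4, 2 * (R : ℤ) + 4 ≤ |x i k - x i' k|) → ∀ T : Finset (Fin n),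
      ∫ φ, Real.exp (∑ i ∈ T, (R : ℝ) ^ 4 / C₁ *
        |(ν4[fun φ' : Site 4 → ℝ => (φ' (x i + e (j i)) - φ' (x i)) ^ 2 |
            MeasurableSpace.comap (fun (φ' : Site 4 → ℝ) (w : {w : Site 4 // w ∉ (sbox (R + 1)).image (fun z => x i + z)}) => φ' w)
              inferInstance]) φ -
          ∫ φ', (φ' (x i + e (j i)) - φ' (x i)) ^ 2 ∂ν4|) ∂ν4 ≤ Real.exp (B * #T) := by
  classical
  obtain ⟨C₁, B, hC₁, hRM⟩ := gff_responseMoments hν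
  refine ⟨C₁, B, hC₁, fun R hR n j x hsep T => ?_⟩
  have hP := hν.1.isProbabilityMeasure
  have hb := hRM R hR n j x hsep T
  -- per cube: the conditional expectation, centred, equals `Q_i − ∫Q_i` a.e.
  have hae : ∀ i : Fin n, ∀ᵐ φ ∂ν4,
      (ν4[fun φ' : Site 4 → ℝ => (φ' (x i + e (j i)) - φ' (x i)) ^ 2 |
          MeasurableSpace.comap (fun (φ' : Site 4 → ℝ) (w : {w : Site 4 // w ∉ (sbox (R + 1)).image (fun z => x i + z)}) => φ' w)
            inferInstance]) φ - ∫ φ', (φ' (x i + e (j i)) - φ' (x i)) ^ 2 ∂ν4 =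
        ((φ (x i + e (j i)) - dirichletField ((sbox (R + 1)).image (fun z => x i + z)) φ (x i + e (j i))) -
            (φ (x i) - dirichletField ((sbox (R + 1)).image (fun z => x i + z)) φ (x i))) ^ 2 -
          ∫ φ', ((φ' (x i + e (j i)) - dirichletField ((sbox (R + 1)).image (fun z => x i + z)) φ' (x i + e (j i))) -
            (φ' (x i) - dirichletField ((sbox (R + 1)).image (fun z => x i + z)) φ' (x i))) ^ 2 ∂ν4 := by
    intro i
    set Λ : Finset (Site 4) := (sbox (R + 1)).image (fun z => x i + z) with hΛ
    have hx : x i ∈ Λ := by have h := add_mem_image_sbox (x i) (zero_mem_sbox (R + 1)); rwa [add_zero] at h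
    have hxe : x i + Pi.single (j i) 1 ∈ Λ := add_mem_image_sbox (x i) (e_mem_sbox (by omega) (j i))
    have hext_m : Measurable (fun (φ' : Site 4 → ℝ) (w : {w : Site 4 // w ∉ Λ}) => φ' w) :=
      measurable_pi_lambda _ fun w => measurable_pi_apply _
    have hkey := condExp_gradient_sq_exterior hν (by norm_num) Λ hx hxe
    simp only [← e_def] at hkey
    -- means: `E(∇φ)² = E Q + E b²` by integrating the kernel identity
    have hψ2 : ∀ y : Site 4, MemLp (fun φ : Site 4 → ℝ => dirichletField Λ φ y) 2 ν4 := fun y =>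
      ((hν.isGaussianProcess_dirichletField Λ).hasGaussianLaw_eval y).memLp_two
    have hQi : Integrable (fun φ : Site 4 → ℝ => ((φ (x i + e (j i)) - dirichletField Λ φ (x i + e (j i))) -
        (φ (x i) - dirichletField Λ φ (x i))) ^ 2) ν4 :=
      (((hν.memLp_coord _).sub (hψ2 _)).sub ((hν.memLp_coord _).sub (hψ2 _))).integrable_sq
    have hmean : ∫ φ', (φ' (x i + e (j i)) - φ' (x i)) ^ 2 ∂ν4 =
        ∫ φ', ((φ' (x i + e (j i)) - dirichletField Λ φ' (x i + e (j i))) - (φ' (x i) - dirichletField Λ φ' (x i))) ^ 2 ∂ν4 +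
          ∫ φ', (dirichletField Λ φ' (x i + e (j i)) - dirichletField Λ φ' (x i)) ^ 2 ∂ν4 := by
      rw [← integral_condExp hext_m.comap_le (f := fun φ' : Site 4 → ℝ => (φ' (x i + e (j i)) - φ' (x i)) ^ 2),
        integral_congr_ae hkey, integral_add hQi (integrable_const _), integral_const, probReal_univ, one_smul]
    filter_upwards [hkey] with φ hφ
    rw [hφ, hmean]
    ring
  have hall : ∀ᵐ φ ∂ν4, ∀ i ∈ T,
      (ν4[fun φ' : Site 4 → ℝ => (φ' (x i + e (j i)) - φ' (x i)) ^ 2 |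
          MeasurableSpace.comap (fun (φ' : Site 4 → ℝ) (w : {w : Site 4 // w ∉ (sbox (R + 1)).image (fun z => x i + z)}) => φ' w)
            inferInstance]) φ - ∫ φ', (φ' (x i + e (j i)) - φ' (x i)) ^ 2 ∂ν4 =
        ((φ (x i + e (j i)) - dirichletField ((sbox (R + 1)).image (fun z => x i + z)) φ (x i + e (j i))) -
            (φ (x i) - dirichletField ((sbox (R + 1)).image (fun z => x i + z)) φ (x i))) ^ 2 -
          ∫ φ', ((φ' (x i + e (j i)) - dirichletField ((sbox (R + 1)).image (fun z => x i + z)) φ' (x i + e (j i))) -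
            (φ' (x i) - dirichletField ((sbox (R + 1)).image (fun z => x i + z)) φ' (x i))) ^ 2 ∂ν4 :=
    (Filter.eventually_all_finset T).2 fun i _ => hae i
  refine le_of_eq_of_le (integral_congr_ae ?_) hb
  filter_upwards [hall] with φ hφ
  exact congrArg Real.exp (Finset.sum_congr rfl fun i hi => by rw [hφ i hi])

end CondExpLaw

end Summit.QuantumFields.YangMills.Cruxes.UVSeamRec.GaussianCalibration

end
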